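import Summits.QuantumFields.QCD.Theses.SpectralDefectExtinction
import Summits.QuantumFields.QCD.Theorems.RobustYangMillsHandover.Negative.ChiralityObstruction

/-!
# `ChiralDescent` (crux stmt-QuantumFields-17527, route SpectralDefectExtinction) — the INFIMUM DESCENT
# reduction, landed definition-free (line `Sketch`, lead seat 0, 2026-08-17)

The crux reads `∀ N_f ∈ {2,3}, Threshold N_f → QCDOf N_f`, where `Threshold N_f` says that ONE mass-scaling
regularisation `reg` carries the per-tuple body of the re-typed conjunct (OS data with `IsQCDAlong`, non-trivial
non-Gaussian glue, dynamical quarks, one rate `Δ > 0` for `T.HasMassGap` and `HasLatticeMassGap`) at every tuple above a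
threshold `M₁`.  The only regularisations a proof can NAME for `QCDOf N_f` are the `m_crit`-shifts of `reg`
(`Cruxes/ChiralDescent/Disproof.lean` §3: data-level descents are exhausted), and the shift by `μ` is a witness iff the body
holds above `μ` and `reg` has NO uniform lattice gap just above `μ` (`qcdOf_of_bodyAbove_of_noUniformGapAbove`; converse:
the landed `not_isChiralAtZero_mcrit_shift_of_uniformGapAbove`).  This file records, kernel-checked and WITHOUT any new
definition, the order-theoretic reduction of the crux idea card `Cruxes/ChiralDescent/Ideas/infimum-descent.md`:

* `exists_threshold_not_gapProp` — the INFIMUM DESCENT in its honest generality: for any per-tuple property `P` on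
  `Fin N_f → ℝ` (`0 < N_f`) and any property `G` of offsets, if (OPENNESS) "`P` above `μ` and `G μ` ⟹ `P` above `μ − δ`"
  and (FINITENESS) "`P` everywhere ⟹ `¬ G` somewhere", then a non-empty up-set `{μ | P above μ}` contains an offset `μ`
  with `¬ G μ` — either the up-set is all of `ℝ` (finiteness) or its infimum is attained (pick an element below
  `min_f m_f`) and `G` there would push `inf − δ` into the set.
* `qcdOf_of_bodyAbove_of_noUniformGapAbove` — the shifted witness (`HasMassScaling` is shift-blind; chirality of the
  shift IS the failure of every rate just above `μ`, `isChiralAtZero_mcrit_shift_iff`; the shift runs at `m > 0` the scheme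
  of `reg` at `μ + m`).
* `qcdOf_of_threshold_of_openness_of_finiteChiralPoint` — per `N_f`: Threshold data for `reg` + OPENNESS (H1) for `reg` +
  FINITE CHIRAL POINT (H2) for `reg` ⟹ `QCDOf N_f`.
* `chiralDescent_of_openness_of_finiteChiralPoint` — the crux BY NAME from H1 and H2 quantified over `N_f ∈ {2,3}` and all
  mass-scaling regularisations (the two registered physics stubs `stub_openness`, `stub_finiteChiralPoint` of the line
  skeleton `Cruxes/ChiralDescent/Lines/Sketch.lean`, the latter there fed with the landed first lemmas
  `stub_noAnalyticAnomaly` p134287 and `stub_goldstoneFluxBound` p134184).  Conditional on H1/H2 — that is the point: it is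
  the exhaustive split of the crux (any proof yields H1 at the infimum and H2 for the hypothesis' `reg`).

Everything is stated in TREE VOCABULARY (the body is spelled out verbatim each time), so the file carries no `def` and
future skeletons / the sibling cruxes `RobustYangMillsHandover` (8892), `AnomalyRigidity.AnomalousWardTriple` (17716) can
import it.  Pure logic over `QCDOS.lean`; standard axioms.
-/

namespace Summit.QuantumFields.QCD.Cruxes.ChiralDescent.InfimumDescent

open Filter
open Literature.MathematicalPhysics.QuantumFieldTheory
open Summit.QuantumFields.QCD.Theorems.RobustYangMillsHandover.Negative

variable {Nf : ℕ}

/-! ## §1 The infimum descent (pure order theory on `Fin N_f → ℝ`) -/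

/-- Every real tuple lies strictly above some flavour-blind offset (`−Σ_f |m_f| − 1`). [folklore] -/
theorem neg_sum_abs_sub_one_lt (m : Fin Nf → ℝ) (f : Fin Nf) : -(∑ g, |m g|) - 1 < m f := by
  have h1 : -|m f| ≤ m f := neg_abs_le (m f)
  have h2 : |m f| ≤ ∑ g, |m g| :=
    Finset.single_le_sum (f := fun g => |m g|) (fun g _ => abs_nonneg (m g)) (Finset.mem_univ f)
  linarith

/-- **Attained infimum.** For `0 < N_f` and any per-tuple property `P`: if the up-set `{μ | P holds at every tuple above μ}`
is non-empty and bounded below, its infimum belongs to it — a tuple above the infimum is above some element of the set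
below `min_f m_f`. [folklore] -/
theorem forall_above_csInf (hNf : 0 < Nf) (P : (Fin Nf → ℝ) → Prop)
    (hne : {μ : ℝ | ∀ m : Fin Nf → ℝ, (∀ f, μ < m f) → P m}.Nonempty)
    (hbdd : BddBelow {μ : ℝ | ∀ m : Fin Nf → ℝ, (∀ f, μ < m f) → P m}) :
    ∀ m : Fin Nf → ℝ, (∀ f, sInf {μ : ℝ | ∀ m : Fin Nf → ℝ, (∀ f, μ < m f) → P m} < m f) → P m := by
  classical
  intro m hm
  have hN : (Finset.univ : Finset (Fin Nf)).Nonempty := ⟨⟨0, hNf⟩, Finset.mem_univ _⟩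
  obtain ⟨f₀, -, hf₀⟩ := Finset.exists_min_image Finset.univ m hN
  obtain ⟨μ', hμ'S, hμ'lt⟩ := exists_lt_of_csInf_lt hne (hm f₀)
  have _ := hbdd
  exact hμ'S m fun f => lt_of_lt_of_le hμ'lt (hf₀ f (Finset.mem_univ f))

/-- **INFIMUM DESCENT (general form).** Let `P` be a per-tuple property (`0 < N_f`) and `G` a property of offsets such
that (OPENNESS) whenever `P` holds above `μ` and `G μ`, `P` holds above `μ − δ` for some `δ > 0`, and (FINITENESS) if `P`
holds at every tuple then `¬ G μ` for some `μ`.  If `P` holds above some `M₁`, then there is an offset `μ` above which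
`P` holds and at which `G` fails.  Proof: the up-set `S = {μ | P above μ}` is non-empty; if it is unbounded below it is
all of `ℝ` and FINITENESS applies; otherwise `inf S ∈ S` (`forall_above_csInf`) and `G (inf S)` would put `inf S − δ`
into `S`, against `csInf_le`. [folklore] -/
theorem exists_threshold_not_gapProp (hNf : 0 < Nf) (P : (Fin Nf → ℝ) → Prop) (G : ℝ → Prop)
    (hopen : ∀ μ : ℝ, (∀ m : Fin Nf → ℝ, (∀ f, μ < m f) → P m) → G μ →
      ∃ δ > (0 : ℝ), ∀ m : Fin Nf → ℝ, (∀ f, μ - δ < m f) → P m)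
    (hfin : (∀ m, P m) → ∃ μ : ℝ, ¬ G μ)
    {M₁ : ℝ} (hM : ∀ m : Fin Nf → ℝ, (∀ f, M₁ < m f) → P m) :
    ∃ μ : ℝ, (∀ m : Fin Nf → ℝ, (∀ f, μ < m f) → P m) ∧ ¬ G μ := by
  classical
  set S : Set ℝ := {μ : ℝ | ∀ m : Fin Nf → ℝ, (∀ f, μ < m f) → P m} with hS
  have hne : S.Nonempty := ⟨M₁, hM⟩
  by_cases hbdd : BddBelow S
  · have hinf : sInf S ∈ S := forall_above_csInf hNf P hne hbdd
    refine ⟨sInf S, hinf, fun hG => ?_⟩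
    obtain ⟨δ, hδ, hB'⟩ := hopen _ hinf hG
    have hle : sInf S ≤ sInf S - δ := csInf_le hbdd hB'
    linarith
  · have hall : ∀ μ, μ ∈ S := by
      intro μ
      rw [bddBelow_def] at hbdd
      push Not at hbdd
      obtain ⟨y, hyS, hy⟩ := hbdd μ
      exact fun m hm => hyS m fun f => lt_of_le_of_lt hy.le (hm f)
    obtain ⟨μ, hμ⟩ := hfin fun m => hall _ m (neg_sum_abs_sub_one_lt m)
    exact ⟨μ, hall μ, hμ⟩

/-! ## §2 The shifted witness and the reduction of the crux -/

/-- **The shifted witness.** If every tuple above `μ` carries the body of the re-typed conjunct along `reg` and `reg` has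
NO uniform lattice gap just above `μ` (every rate `ε > 0` fails at some tuple above `μ`), then the `m_crit`-shift of
`reg` by `μ` (`m_crit(k) ↦ m_crit(k) + a_k μ / Z_m(k)`) witnesses `QCDOf N_f`: mass scaling is shift-blind
(`hasMassScaling_mcrit_shift_iff`), chirality of the shift is exactly the failure of every rate just above `μ`
(`isChiralAtZero_mcrit_shift_iff`), and the shift runs at masses `m > 0` the scheme of `reg` at `μ + m`. [folklore] -/
theorem qcdOf_of_bodyAbove_of_noUniformGapAbove (reg : QCDRegularisation Nf) (hMS : reg.HasMassScaling) (μ : ℝ)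
    (hB : ∀ m : Fin Nf → ℝ, (∀ f, μ < m f) →
      ∃ (z shift : QCDField Nf → ℕ → ℝ) (T : OSData (QCDField Nf) 4),
        IsQCDAlong (reg.scheme m z shift) T ∧ T.IsNontrivial QCDField.glue ∧ T.IsNonGaussian QCDField.glue ∧
          (∀ f g : Fin Nf, f ≠ g → T.IsNontrivial (QCDField.pseudoRe f g)) ∧
            ∃ Δ > 0, T.HasMassGap Δ ∧ (reg.scheme m z shift).HasLatticeMassGap Δ)
    (hG : ∀ ε > (0 : ℝ), ∃ m : Fin Nf → ℝ, (∀ f, μ < m f) ∧ ¬ (reg.scheme m 0 0).HasLatticeMassGap ε) :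
    QCDOf Nf := by
  refine ⟨{ reg with mcrit := fun k => reg.mcrit k + reg.a k * μ / reg.Zm k },
    (hasMassScaling_mcrit_shift_iff reg μ).mpr hMS, ?_, ?_⟩
  · rw [isChiralAtZero_mcrit_shift_iff]
    intro ε hε
    obtain ⟨m, hm, hng⟩ := hG ε hε
    refine ⟨fun f => m f - μ, fun f => sub_pos.mpr (hm f), ?_⟩
    have heq : (fun f => μ + (m f - μ)) = m := funext fun f => by ring
    rw [heq]
    exact hng
  · intro m hm
    have hs : ∀ (z shift : QCDField Nf → ℕ → ℝ),
        ({ reg with mcrit := fun k => reg.mcrit k + reg.a k * μ / reg.Zm k } : QCDRegularisation Nf).scheme m z shift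
          = reg.scheme (fun f => μ + m f) z shift := by
      intro z shift
      simp only [QCDRegularisation.scheme, QCDScheme.mk.injEq, true_and, and_true]
      funext f k
      ring
    obtain ⟨z, shift, T, hT⟩ := hB (fun f => μ + m f) (fun f => lt_add_of_pos_right μ (hm f))
    exact ⟨z, shift, T, by rw [hs]; exact hT⟩

/-- **`QCDOf N_f` from a threshold, OPENNESS and FINITE CHIRAL POINT (per flavour number).** For `0 < N_f` and a
mass-scaling `reg` carrying the body above `M₁`: if (H1, for this `reg`) the body above `μ` plus ONE lattice rate above
`μ` forces the body above `μ − δ`, and (H2, for this `reg`) the body at every tuple forces, above some offset, every rate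
to fail at some tuple — then `QCDOf N_f`, witnessed by the shift of `reg` to the offset produced by the infimum descent.
[folklore] -/
theorem qcdOf_of_threshold_of_openness_of_finiteChiralPoint (hNf : 0 < Nf) (reg : QCDRegularisation Nf)
    (hMS : reg.HasMassScaling)
    (h1 : ∀ μ : ℝ,
      (∀ m : Fin Nf → ℝ, (∀ f, μ < m f) →
        ∃ (z shift : QCDField Nf → ℕ → ℝ) (T : OSData (QCDField Nf) 4),
          IsQCDAlong (reg.scheme m z shift) T ∧ T.IsNontrivial QCDField.glue ∧ T.IsNonGaussian QCDField.glue ∧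
            (∀ f g : Fin Nf, f ≠ g → T.IsNontrivial (QCDField.pseudoRe f g)) ∧
              ∃ Δ > 0, T.HasMassGap Δ ∧ (reg.scheme m z shift).HasLatticeMassGap Δ) →
      (∃ ε > (0 : ℝ), ∀ m : Fin Nf → ℝ, (∀ f, μ < m f) → (reg.scheme m 0 0).HasLatticeMassGap ε) →
      ∃ δ > (0 : ℝ), ∀ m : Fin Nf → ℝ, (∀ f, μ - δ < m f) →
        ∃ (z shift : QCDField Nf → ℕ → ℝ) (T : OSData (QCDField Nf) 4),
          IsQCDAlong (reg.scheme m z shift) T ∧ T.IsNontrivial QCDField.glue ∧ T.IsNonGaussian QCDField.glue ∧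
            (∀ f g : Fin Nf, f ≠ g → T.IsNontrivial (QCDField.pseudoRe f g)) ∧
              ∃ Δ > 0, T.HasMassGap Δ ∧ (reg.scheme m z shift).HasLatticeMassGap Δ)
    (h2 : (∀ m : Fin Nf → ℝ,
        ∃ (z shift : QCDField Nf → ℕ → ℝ) (T : OSData (QCDField Nf) 4),
          IsQCDAlong (reg.scheme m z shift) T ∧ T.IsNontrivial QCDField.glue ∧ T.IsNonGaussian QCDField.glue ∧
            (∀ f g : Fin Nf, f ≠ g → T.IsNontrivial (QCDField.pseudoRe f g)) ∧
              ∃ Δ > 0, T.HasMassGap Δ ∧ (reg.scheme m z shift).HasLatticeMassGap Δ) →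
        ∃ μ : ℝ, ∀ ε > (0 : ℝ), ∃ m : Fin Nf → ℝ, (∀ f, μ < m f) ∧ ¬ (reg.scheme m 0 0).HasLatticeMassGap ε)
    {M₁ : ℝ}
    (hbody : ∀ m : Fin Nf → ℝ, (∀ f, M₁ < m f) →
      ∃ (z shift : QCDField Nf → ℕ → ℝ) (T : OSData (QCDField Nf) 4),
        IsQCDAlong (reg.scheme m z shift) T ∧ T.IsNontrivial QCDField.glue ∧ T.IsNonGaussian QCDField.glue ∧
          (∀ f g : Fin Nf, f ≠ g → T.IsNontrivial (QCDField.pseudoRe f g)) ∧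
            ∃ Δ > 0, T.HasMassGap Δ ∧ (reg.scheme m z shift).HasLatticeMassGap Δ) :
    QCDOf Nf := by
  obtain ⟨μ, hB, hG⟩ := exists_threshold_not_gapProp hNf
    (fun m => ∃ (z shift : QCDField Nf → ℕ → ℝ) (T : OSData (QCDField Nf) 4),
      IsQCDAlong (reg.scheme m z shift) T ∧ T.IsNontrivial QCDField.glue ∧ T.IsNonGaussian QCDField.glue ∧
        (∀ f g : Fin Nf, f ≠ g → T.IsNontrivial (QCDField.pseudoRe f g)) ∧
          ∃ Δ > 0, T.HasMassGap Δ ∧ (reg.scheme m z shift).HasLatticeMassGap Δ)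
    (fun μ => ∃ ε > (0 : ℝ), ∀ m : Fin Nf → ℝ, (∀ f, μ < m f) → (reg.scheme m 0 0).HasLatticeMassGap ε)
    h1
    (fun hall => by
      obtain ⟨μ, hμ⟩ := h2 hall
      refine ⟨μ, ?_⟩
      rintro ⟨ε, hε, hgap⟩
      obtain ⟨m, hm, hng⟩ := hμ ε hε
      exact hng (hgap m hm))
    hbody
  refine qcdOf_of_bodyAbove_of_noUniformGapAbove reg hMS μ hB fun ε hε => ?_
  by_contra hcon
  push Not at hcon
  exact hG ⟨ε, hε, fun m hm => hcon m hm⟩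

/-- **`ChiralDescent` from OPENNESS (H1) and FINITE CHIRAL POINT (H2)**, both quantified over `N_f ∈ {2,3}` and all
mass-scaling regularisations — the two registered physics stubs of the line skeleton `Cruxes/ChiralDescent/Lines/Sketch.lean`
(`stub_openness`, and `stub_finiteChiralPoint` once fed with the landed `stub_noAnalyticAnomaly` / `stub_goldstoneFluxBound`).
The guard supplies `0 < N_f` for the attained infimum.  CONDITIONAL on H1/H2 (open-problem class: light-quark continuation
of the construction below a uniformly gapped offset; OS-level gaplessness at the chiral point) — the exhaustive split of the
crux, recorded so that no later seat re-derives it. [folklore] -/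
theorem chiralDescent_of_openness_of_finiteChiralPoint
    (h1 : ∀ Nf : ℕ, (Nf = 2 ∨ Nf = 3) → ∀ reg : QCDRegularisation Nf, reg.HasMassScaling → ∀ μ : ℝ,
      (∀ m : Fin Nf → ℝ, (∀ f, μ < m f) →
        ∃ (z shift : QCDField Nf → ℕ → ℝ) (T : OSData (QCDField Nf) 4),
          IsQCDAlong (reg.scheme m z shift) T ∧ T.IsNontrivial QCDField.glue ∧ T.IsNonGaussian QCDField.glue ∧
            (∀ f g : Fin Nf, f ≠ g → T.IsNontrivial (QCDField.pseudoRe f g)) ∧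
              ∃ Δ > 0, T.HasMassGap Δ ∧ (reg.scheme m z shift).HasLatticeMassGap Δ) →
      (∃ ε > (0 : ℝ), ∀ m : Fin Nf → ℝ, (∀ f, μ < m f) → (reg.scheme m 0 0).HasLatticeMassGap ε) →
      ∃ δ > (0 : ℝ), ∀ m : Fin Nf → ℝ, (∀ f, μ - δ < m f) →
        ∃ (z shift : QCDField Nf → ℕ → ℝ) (T : OSData (QCDField Nf) 4),
          IsQCDAlong (reg.scheme m z shift) T ∧ T.IsNontrivial QCDField.glue ∧ T.IsNonGaussian QCDField.glue ∧
            (∀ f g : Fin Nf, f ≠ g → T.IsNontrivial (QCDField.pseudoRe f g)) ∧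
              ∃ Δ > 0, T.HasMassGap Δ ∧ (reg.scheme m z shift).HasLatticeMassGap Δ)
    (h2 : ∀ Nf : ℕ, (Nf = 2 ∨ Nf = 3) → ∀ reg : QCDRegularisation Nf, reg.HasMassScaling →
      (∀ m : Fin Nf → ℝ,
        ∃ (z shift : QCDField Nf → ℕ → ℝ) (T : OSData (QCDField Nf) 4),
          IsQCDAlong (reg.scheme m z shift) T ∧ T.IsNontrivial QCDField.glue ∧ T.IsNonGaussian QCDField.glue ∧
            (∀ f g : Fin Nf, f ≠ g → T.IsNontrivial (QCDField.pseudoRe f g)) ∧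
              ∃ Δ > 0, T.HasMassGap Δ ∧ (reg.scheme m z shift).HasLatticeMassGap Δ) →
      ∃ μ : ℝ, ∀ ε > (0 : ℝ), ∃ m : Fin Nf → ℝ, (∀ f, μ < m f) ∧ ¬ (reg.scheme m 0 0).HasLatticeMassGap ε) :
    Summit.QuantumFields.QCD.Theses.SpectralDefectExtinction.ChiralDescent := by
  unfold Summit.QuantumFields.QCD.Theses.SpectralDefectExtinction.ChiralDescent
  rintro Nf hNf ⟨reg, hMS, M₁, -, hbody⟩
  have hNf0 : 0 < Nf := by rcases hNf with rfl | rfl <;> norm_num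
  exact qcdOf_of_threshold_of_openness_of_finiteChiralPoint hNf0 reg hMS (h1 Nf hNf reg hMS) (h2 Nf hNf reg hMS) hbody

end Summit.QuantumFields.QCD.Cruxes.ChiralDescent.InfimumDescent
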